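import Summits.QuantumFields.QCD.Theses.NestedDissectionSea
import Literature.MathematicalPhysics.QuantumFieldTheory.QCDPhaseQuenched
import Summits.QuantumFields.QCD.Theorems.NestedDissectionSeaNegativeCellsDiluteStubSignMobility
import Summits.QuantumFields.QCD.Theorems.NestedDissectionSeaSignDefectForcesCrossing
import Summits.QuantumFields.QCD.Theorems.NegativeCellsDilute.Negative.CellPositivity
import Summits.QuantumFields.QCD.Theorems.NegativeCellsDilute.Negative.PinWindow
import Summits.QuantumFields.QCD.Theorems.NegativeCellsDilute.Negative.UniformPinFalse

/-!
# Line `exterior-conditioned-parity` — crux `NegativeCellsDilute` (stmt-QuantumFields-13900) — CHECKED SKELETON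

Crux-strategist planner-cstrat-stmt-QuantumFields-13900-p1-0 (wall-breaker on the exhausted chain), 2026-08-17.
Card: `Lines/exterior-conditioned-parity.md`. Namespace `…Cruxes.NegativeCellsDilute.ExteriorConditionedParity`.

## Why a new line (the recorded death, and how this skeleton dodges it)

All three registered lines died at ONE stub of the same shape: "ONE admissible `∃ reg` carrying (an (a)-type bound) ∧
BLOCK FLOOR ∧ RATIO MIXING" (`Lines/*-dead.md`). Diagnosis: the floor was asked of a block of PHYSICAL size (strongly
coupled inside: not semiclassical even in principle), the mixing is clustering at physical separation (IR / confinement),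
and the conjunction had to ride under the line's own `∃ reg` because clause (a) is junk-true on high lines (Disproof §2/§4).

This line changes all three points:
1. **No `∃ reg` in any stub.** The regularisation is EXPLICIT: `lineReg Nf T` = `canonicalAF` (a_k = 1/(k+1),
   two-loop β_k with Λ_lat = 1, canonical Z_m) with the critical mass LOCATED by a supremum, `jumpLine Nf T k` = (sup of
   the bare masses ν ∈ [−8, 1] at which, on the reference torus of physical side ≈ 1/Λ_lat, with N_f degenerate sea quarks
   at ν + a_kT/Z_m, the determinant at ν − a_kT/Z_m is negative with phase-quenched probability ≥ 3/8) − a_kT/Z_m. Every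
   open stub is a separate statement ABOUT THIS SEQUENCE (universal in the depth T ≥ T₀ and in the block data), so the
   stubs are individually meaningful one-sided statements and the composition does the parameter choosing.
2. **No mixing.** `⟨σ⟩ = ⟨σ(1 − 2 m_B)⟩` for the heat-bath resampling of ANY link set `B` (landed `stub_signMobility`,
   p93848) gives `|⟨σ⟩| ≤ ⟨|1 − 2 m_B|⟩` (`stub_pinOfNearHalfResampling`): the pin needs ONE link set whose flip
   propensity is within 1/4 of 1/2 on average — take `B` = the union of `K` separated blocks and CONDITION ON THE EXTERIOR:
   under the exterior-conditional law the pure-gauge factor is an exact product over blocks (finite-range action), so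
   `1 − 2 m_B^{loc} = ∏_i (1 − 2 r_i)` up to the heavy-sea quasi-locality error (`stub_quasiProduct`, exact at N_f = 0) and
   the sign-locality error (`stub_signLocality`: global flip = product of enlarged-Dirichlet-box parity flips); then a
   TWO-SIDED per-block floor `r_i ∈ [p₀, 1 − p₀]` (`stub_blockParityFloor`) gives `|1 − 2 m_B| ≲ (1 − 2p₀)^K → 0`. The IR
   (strong coupling at the torus scale, arbitrarily large tori `∀ S`) lives only in the exterior, which is conditioned on and
   never controlled; `K` and `R` may be astronomically large (the crux puts `∃ R` after `∀ m`).
3. **Small blocks, heavy sea.** The floor is asked of blocks of physical side `L_b ≤ L₀(m)` — as small as the prover likes,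
   hence weakly coupled THROUGHOUT (g(L_b) ≪ 1): a semiclassical statement (an odd number of instantons of size ≍ L_b/4 in
   the block, given the boundary, has conditional probability ≍ (L_bΛ)^{b} > 0, k-uniformly: the UV-convergent end of the
   instanton measure, 't Hooft 1976 / Lüscher 1982) in Bałaban's regime (all running couplings small), not a χ_t > 0
   statement about the confining vacuum; and the threshold `M₀ = 2T` is HEAVY (prover's T), so the phase-quenched weight is
   quasi-local at the scale 1/M₀ ≪ L_b (heavy-quark decoupling), which is what `stub_quasiProduct` asks.
Clause (a) comes from `stub_uvEarlyCrossers`: the parity-free early-crosser bound (a′) along `lineReg Nf T` with the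
prover's window `ℓ` (taken ≪ 1/Λ: every window cell weakly coupled; content = UV early-crosser large deviation, route
L4/L5), turned into (a) by the landed `signDefectForcesCrossing_proof` inside the composition.

## Registered stubs (6; `sorry` only inside `stub_*`)
* `stub_pinOfNearHalfResampling` — PROVABLE NOW (M): near-half union propensity ⇒ clause (b) verbatim (sign-mobility p93848
  + `|σ| = 1` + the quotient identification of `stub_pinOfFloor` p93706).
* `stub_nearHalfOfLocalParities` — PROVABLE NOW (M): the pointwise/integrated inequality
  `⟨|1−2m_B|⟩ ≤ (1−2p₀)^K + ⟨|(1−2m^loc) − ∏(1−2r_i)|⟩ + 2⟨|m_B − m^loc|⟩ + 2 P(∃ i, r_i ∉ [p₀, 1−p₀])` for the concrete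
  conditional propensities (measurability of parametric Haar-integral quotients, as in p93848).
* `stub_signLocality` — OPEN (UV): `⟨|m_B − m_B^loc|⟩ ≤ 1/32` along `lineReg`.
* `stub_quasiProduct` — OPEN (UV; an identity at N_f = 0): `⟨|(1 − 2m^loc) − ∏(1 − 2r_i)|⟩ ≤ 1/32` along `lineReg`.
* `stub_blockParityFloor` — OPEN (UV semiclassics; the line's HARDEST stub): separated block families exist with
  `P(∃ i, r_i ∉ [p₀, 1−p₀]) ≤ 1/32`, `p₀ = p₀(m, L_b) > 0` k-uniform.
* `stub_uvEarlyCrossers` — OPEN (UV): the parity-free early-crosser bound (a′) along `lineReg` (⇒ (a) by landed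
  `signDefectForcesCrossing_proof`).
Composition `NegativeCellsDilute_of` (sorry-free): T := max Tᵢ, M₀ := 2T, L_b := min Lᵢ, K from `(1−2p₀)^K ≤ 1/32`,
d₀ := D₀(K), R := max Rᵢ; (a) from stub 6 + landed `signDefectForcesCrossing_proof`; (b) from stub 1 fed by stub 2 and
stubs 3–5 (6/32 ≤ 1/2).

## Disproof used (`Cruxes/NegativeCellsDilute/Disproof.lean` v5.2, NO KILL; landed Negatives imported above)
§2/§4 sandwich (`withoutPin_holds`, `crux_of_highLinePin`, `pinClause_of_crux`): honoured structurally — the pin is DERIVED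
(stubs 1–5), never assumed, and no stub is junk-true on a high line: if the locator's set is empty (`sSup ∅ = 0`,
`jumpLine = −a_kT/Z_m`, a high line) then `stub_blockParityFloor` is FALSE there (flip propensities need genuine crossings
near the edge `4` of `K_U`: the Lifshitz-tail event of §4 `¬HighLinePin`), so the line dies honestly at its hardest stub
rather than junk-proving the crux. §1/§5 pin window: the locator ranges over `[−8, 1]` and Seiler positivity empties `refNeg`
for probes `> 0`, so `jumpLine ∈ [−8 − a_kT/Z_m, 0]` automatically. §3 `not_negativeCellsDiluteUniformPin`: every stub keeps
the crux's order `∀ M > M₀, ∀ᶠ k` (k₀ may grow with M). `StripLawForallEtaFalse` / `SeedActionFloorFalse`: not applicable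
(no η-strip, no seed notion). `UnitaryHaarSmallBall` (barrier): the floor is NOT a Haar small-ball bound — p₀ must come
from Gaussian integration around the lattice instanton with its one-loop determinant (dimensional transmutation), see card.
-/

noncomputable section

namespace Summit.QuantumFields.QCD.Cruxes.NegativeCellsDilute.ExteriorConditionedParity

open scoped BigOperators Classical
open MeasureTheory Filter
open Literature.MathematicalPhysics.QuantumLattice Literature.MathematicalPhysics.QuantumFieldTheory
  Literature.Probability.LatticeModels
open Summit.QuantumFields.QCD.Theses.NestedDissectionSea (NegativeCellsDilute)

/-! ## Vocabulary (line-posited abbreviations over tree declarations; a lead landing a stub inlines them or files them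
as `Theorems/NestedDissectionSeaDefs.lean`) -/

section Vocabulary

variable {N : ℕ} [NeZero N] {Nf : ℕ}

/-- Bare sea masses `m_f(k) = mcrit k + a_k m_f / Z_m k` of `reg` at step `k` (the crux's `let mq`). -/
def mqOf (reg : QCDRegularisation Nf) (m : Fin Nf → ℝ) (k : ℕ) : Fin Nf → ℝ :=
  fun f => reg.mcrit k + reg.a k * m f / reg.Zm k

/-- The pin probe `mcrit k − a_k M / Z_m k` (depth `M` below the line). -/
def probeOf (reg : QCDRegularisation Nf) (M : ℝ) (k : ℕ) : ℝ :=
  reg.mcrit k - reg.a k * M / reg.Zm k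

/-- Lattice length `⌈L / a_k⌉` of a physical length `L` at step `k`. -/
def sideOf (reg : QCDRegularisation Nf) (L : ℝ) (k : ℕ) : ℕ :=
  ⌈L / reg.a k⌉₊

/-- The determinant sign `σ(U) = −1` if `Re det D_W(U, μp, 1) < 0`, else `+1` (tree `fermionDet`, `wilsonDirac`). -/
def detSign (μp : ℝ) (U : GaugeConfig 4 N SU3) : ℝ :=
  if (fermionDet (wilsonDirac (fundamentalRep (Fin 3)) U μp 1)).re < 0 then -1 else 1

/-- The phase-quenched weight `e^{−β S_W(U)} ∏_f |det D_W(U, m_f, 1)|` against the Haar product (as in p93848). -/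
def pqWeight (β : ℝ) (mq : Fin Nf → ℝ) (U : GaugeConfig 4 N SU3) : ℝ :=
  Real.exp (-(β * wilsonAction (fundamentalRep (Fin 3)) U)) *
    ∏ f, ‖fermionDet (wilsonDirac (fundamentalRep (Fin 3)) U (mq f) 1)‖

/-- Refit: replace the links of `U` in the set `B` by those of `V`. -/
def refit (B : Finset (Edge 4 N)) (U V : GaugeConfig 4 N SU3) : GaugeConfig 4 N SU3 :=
  fun e => if e ∈ B then V e else U e

/-- **Exterior-conditional expectation** of a two-point functional `F(U, W)` under heat-bath resampling of the link set
`B` given the exterior of `U`: `∫ F(U, r_B U V) w(r_B U V) dHaar(V) / ∫ w(r_B U V) dHaar(V)` — the conditional law of the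
`B`-links given the complement under the phase-quenched measure (the coordinates of `V` outside `B` are idle). -/
def condExp (β : ℝ) (mq : Fin Nf → ℝ) (B : Finset (Edge 4 N))
    (F : GaugeConfig 4 N SU3 → GaugeConfig 4 N SU3 → ℝ) (U : GaugeConfig 4 N SU3) : ℝ :=
  (∫ V, F U (refit B U V) * pqWeight β mq (refit B U V) ∂(Measure.pi fun _ : Edge 4 N => haarProbability SU3)) /
    (∫ V, pqWeight β mq (refit B U V) ∂(Measure.pi fun _ : Edge 4 N => haarProbability SU3))

/-- **Flip propensity** `m_B(U)`: conditional probability that resampling `B` flips the determinant sign at the probe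
(VERBATIM the `mB` of landed `stub_signMobility`, p93848, up to the names above). -/
def flipProp (β : ℝ) (mq : Fin Nf → ℝ) (μp : ℝ) (B : Finset (Edge 4 N)) (U : GaugeConfig 4 N SU3) : ℝ :=
  condExp β mq B (fun U W => if detSign μp W ≠ detSign μp U then 1 else 0) U

/-- The link block of lattice side `n` at corner `x`: links based in the cube `[x, x + n)⁴` (as in p93706). -/
def blockLinks (n : ℕ) (x : TorusSite 4 N) : Finset (Edge 4 N) :=
  Finset.univ.filter fun e => ∀ i, (e.1 i - x i).val < n

/-- The union of the `K` blocks with corners `x i`. -/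
def unionLinks (n K : ℕ) (x : Fin K → TorusSite 4 N) : Finset (Edge 4 N) :=
  Finset.univ.biUnion fun i => blockLinks n (x i)

/-- **Local parity** of block `x`: the sign of the (real) Dirichlet determinant, at the probe, of the ENLARGED open box of
corner `x − (n+1)·𝟙` and sides `3n + 2` (its interior is the cube `[x − n, x + 2n]⁴`, a collar of width `n` around the
block) — tree `cellDetRe` (route vocabulary `WilsonCellSchur`). -/
def boxParity (μp : ℝ) (n : ℕ) (x : TorusSite 4 N) (U : GaugeConfig 4 N SU3) : ℝ :=
  if cellDetRe U μp (fun j => x j - ((n + 1 : ℕ) : ZMod N)) (fun _ => 3 * n + 2) < 0 then -1 else 1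

/-- **Local flip propensity** `m_B^{loc}(U)`: conditional probability, under resampling of the UNION of the blocks, that
an ODD number of local parities flip (the product of the `K` before/after parity products is `−1`). -/
def locFlipProp (β : ℝ) (mq : Fin Nf → ℝ) (μp : ℝ) (n K : ℕ) (x : Fin K → TorusSite 4 N)
    (U : GaugeConfig 4 N SU3) : ℝ :=
  condExp β mq (unionLinks n K x)
    (fun U W => if (∏ i, boxParity μp n (x i) W * boxParity μp n (x i) U) = -1 then 1 else 0) U

/-- **Marginal local flip probability** `r_i(U)` of block `i` under resampling of the union. -/
def margFlipProp (β : ℝ) (mq : Fin Nf → ℝ) (μp : ℝ) (n K : ℕ) (x : Fin K → TorusSite 4 N) (i : Fin K)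
    (U : GaugeConfig 4 N SU3) : ℝ :=
  condExp β mq (unionLinks n K x) (fun U W => if boxParity μp n (x i) W ≠ boxParity μp n (x i) U then 1 else 0) U

/-- **Separation** of a block family: any two ENLARGED cubes (side `3n + 3` sites from corner `x − (n+1)·𝟙`) are at
cyclic distance `≥ g` in both directions along some coordinate axis (so no plaquette, and no enlarged Dirichlet box, meets
two of them once `g ≥ 2`). -/
def Separated (n g : ℕ) {K : ℕ} (x : Fin K → TorusSite 4 N) : Prop :=
  ∀ i j, i ≠ j → ∃ d : Fin 4, ∀ t t' : ℕ, t < 3 * n + 3 → t' < 3 * n + 3 →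
    g ≤ ((x i d - ((n + 1 : ℕ) : ZMod N) + (t : ZMod N)) - (x j d - ((n + 1 : ℕ) : ZMod N) + (t' : ZMod N))).val ∧
      g ≤ ((x j d - ((n + 1 : ℕ) : ZMod N) + (t' : ZMod N)) - (x i d - ((n + 1 : ℕ) : ZMod N) + (t : ZMod N))).val

end Vocabulary

/-! ## The line's explicit regularisation: `canonicalAF` with a supremum-LOCATED critical mass -/

section Locator

variable (Nf : ℕ)

/-- Side of the REFERENCE torus at step `k`: `2⌈1/(2a_k)⌉ + 1` sites, physical side `≈ 1 = 1/Λ_lat` for `canonicalAF`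
(`a_k = 1/(k+1)`, `β_k = afBeta N_f 1 a_k`); for Wilson's action `1/Λ_lat` is tens of fm, far above the confinement
scale, so parity mixing on it is the weakest possible global input. -/
def refSide (k : ℕ) : ℕ :=
  2 * ⌈1 / (2 * (QCDRegularisation.canonicalAF Nf).a k)⌉₊ + 1

/-- The reference side is a successor, hence never zero. -/
instance refSide_neZero (k : ℕ) : NeZero (refSide Nf k) := ⟨Nat.succ_ne_zero _⟩

/-- **Reference negativity frequency** at a candidate line `ν` with depth `T`: on the reference torus, with `N_f`
degenerate sea quarks at bare mass `ν + a_kT/Z_m`, the phase-quenched probability that `Re det D_W(U, ν − a_kT/Z_m, 1) < 0`. -/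
def refNeg (T : ℝ) (k : ℕ) (ν : ℝ) : ℝ :=
  let reg₀ := QCDRegularisation.canonicalAF Nf
  let t : ℝ := reg₀.a k * T / reg₀.Zm k
  (∫ U : GaugeConfig 4 (refSide Nf k) SU3,
      (if (fermionDet (wilsonDirac (fundamentalRep (Fin 3)) U (ν - t) 1)).re < 0 then (1 : ℝ) else 0) *
        ∏ _f : Fin Nf, ‖fermionDet (wilsonDirac (fundamentalRep (Fin 3)) U (ν + t) 1)‖
      ∂(wilsonMeasure (d := 4) (L := refSide Nf k) (fundamentalRep (Fin 3)) (reg₀.β k))) /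
    (∫ U : GaugeConfig 4 (refSide Nf k) SU3,
      ∏ _f : Fin Nf, ‖fermionDet (wilsonDirac (fundamentalRep (Fin 3)) U (ν + t) 1)‖
      ∂(wilsonMeasure (d := 4) (L := refSide Nf k) (fundamentalRep (Fin 3)) (reg₀.β k)))

/-- **The located line** `jumpLine N_f T k`: the supremum of the candidate lines `ν ∈ [−8, 1]` with reference negativity
frequency `≥ 3/8`, shifted down by the depth `a_kT/Z_m` (so that, if the parity-jump picture holds, `jumpLine ≈ m_c(β_k)`
to `o(a_k/Z_m)`: below `m_c + a_kT/Z_m` the reference probe sits below the line and `refNeg ≈ P(Q odd) ≈ 1/2`; above it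
`refNeg → 0`). `sSup` of a bounded set of reals; `sSup ∅ = 0` gives the high line `−a_kT/Z_m`, on which the floor stub
is false (Disproof §4), so no junk proof can pass through the locator. The required precision `a_k/Z_m ≪ g₀^{2n}` for
every `n` is why the line is located non-perturbatively (by a quantile of the measure itself), not by a perturbative `m_c`. -/
def jumpLine (T : ℝ) (k : ℕ) : ℝ :=
  sSup {ν : ℝ | ν ∈ Set.Icc (-8 : ℝ) 1 ∧ (3 / 8 : ℝ) ≤ refNeg Nf T k ν} -
    (QCDRegularisation.canonicalAF Nf).a k * T / (QCDRegularisation.canonicalAF Nf).Zm k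

/-- **The line's regularisation**: `canonicalAF` (a_k = 1/(k+1), two-loop β_k with Λ_lat = 1, canonical leading-log
Z_m) with `mcrit := jumpLine N_f T`. -/
def lineReg (T : ℝ) : QCDRegularisation Nf :=
  { QCDRegularisation.canonicalAF Nf with mcrit := jumpLine Nf T }

/-- `lineReg` has leading-log mass scaling (it shares `a`, `Z_m` with `canonicalAF`). -/
theorem lineReg_hasMassScaling (T : ℝ) : (lineReg Nf T).HasMassScaling :=
  QCDRegularisation.canonicalAF_hasMassScaling

/-- `lineReg` scales asymptotically (it shares `a`, `β` with `canonicalAF` / `QCDScheme.zeroAF`). -/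
theorem lineReg_hasAsymptoticScaling (T : ℝ) : ((lineReg Nf T).scheme 0 0 0).HasAsymptoticScaling :=
  QCDScheme.zeroAF_hasAsymptoticScaling

end Locator

/-! ## Registered stubs -/

/-- **Stub 1 — `pinOfNearHalfResampling` (PROVABLE NOW, size M).** For ANY regularisation, threshold, masses and size:
if for every depth `M > M₀`, eventually in `k`, on every odd torus of physical side `≥ R` there is a link set `B` whose
heat-bath flip propensity satisfies `⟨|1 − 2 m_B|⟩₊ ≤ 1/2`, then the crux's parity pin (b) holds VERBATIM. Proof route:
`⟨σ m_B⟩₊ = 0` (landed `stub_signMobility`, p93848, any finite `B`) gives `⟨σ⟩₊ = ⟨σ(1 − 2m_B)⟩₊`, `|σ| = 1` gives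
`|⟨σ⟩₊| ≤ ⟨|1 − 2m_B|⟩₊ ≤ 1/2`, hence `P₊(σ = −1) = (1 − ⟨σ⟩₊)/2 ≥ 1/4`; identify `P₊` with the crux's quotient of
`wilsonMeasure` integrals (`qcdPhaseQuenchedExpect_eq_div_prod`, as in landed `stub_pinOfFloor`, p93706). No mixing, no
covariance hypothesis, one link set. -/
theorem stub_pinOfNearHalfResampling :
    ∀ (Nf : ℕ) (reg : QCDRegularisation Nf) (M₀ : ℝ) (m : Fin Nf → ℝ) (R : ℝ),
      (∀ M : ℝ, M₀ < M → ∀ᶠ k : ℕ in Filter.atTop, ∀ S : ℕ, R ≤ reg.a k * (2 * S + 1) →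
        ∃ B : Finset (Edge 4 (2 * S + 1)),
          qcdPhaseQuenchedExpect (reg.β k) (2 * S + 1) (mqOf reg m k)
            (fun U => |1 - 2 * flipProp (reg.β k) (mqOf reg m k) (probeOf reg M k) B U|) ≤ 1 / 2) →
      (∀ M : ℝ, M₀ < M → ∀ᶠ k : ℕ in Filter.atTop, ∀ S : ℕ, R ≤ reg.a k * (2 * S + 1) → let N : ℕ := 2 * S + 1; let mq : Fin Nf → ℝ := fun f => reg.mcrit k + reg.a k * m f / reg.Zm k; let wt : GaugeConfig 4 N (Matrix.specialUnitaryGroup (Fin 3) ℂ) → ℝ := fun U => ∏ f, ‖fermionDet (wilsonDirac (fundamentalRep (Fin 3)) U (mq f) 1)‖; (1 / 4 : ℝ) ≤ (∫ U, (if (fermionDet (wilsonDirac (fundamentalRep (Fin 3)) U (reg.mcrit k - reg.a k * M / reg.Zm k) 1)).re < 0 then (1 : ℝ) else 0) * wt U ∂(wilsonMeasure (d := 4) (L := N) (fundamentalRep (Fin 3)) (reg.β k))) / (∫ U, wt U ∂(wilsonMeasure (d := 4) (L := N) (fundamentalRep (Fin 3)) (reg.β k)))) := by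
  sorry

/-- **Stub 2 — `nearHalfOfLocalParities` (PROVABLE NOW, size M; concrete, over the phase-quenched measure).** For every
torus, coupling, sea masses, probe, block side `n`, family `x` of `K` corners and every `p₀ ∈ [0, 1/2]`:
`⟨|1 − 2m_B|⟩₊ ≤ (1 − 2p₀)^K + ⟨|(1 − 2m^loc) − ∏_i(1 − 2r_i)|⟩₊ + 2⟨|m_B − m^loc|⟩₊ + 2 P₊(∃ i, r_i ∉ [p₀, 1 − p₀])`
for the union `B` of the blocks. Pointwise: `|1 − 2m_B| ≤ |1 − 2m^loc| + 2|m_B − m^loc|`,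
`|1 − 2m^loc| ≤ |∏(1 − 2r_i)| + |(1 − 2m^loc) − ∏(1 − 2r_i)|`, and `|∏(1 − 2r_i)| ≤ (1 − 2p₀)^K` when all
`r_i ∈ [p₀, 1 − p₀]`, `≤ 1 ≤ (1−2p₀)^K + 1` otherwise (every `r_i ∈ [0, 1]`: a quotient of a sub-integral by the full
integral of a positive weight, `0/0 = 0` included); then integrate against the probability measure `qcdLatticeMeasure`
(`qcdPhaseQuenchedExpect_eq_integral_qcdLatticeMeasure`), proving measurability of the parametric Haar-integral quotients as
in p93848. Pure probability; the content of the line is in stubs 3–5, which bound the three error terms. -/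
theorem stub_nearHalfOfLocalParities :
    ∀ (N : ℕ) [NeZero N] (Nf : ℕ) (β : ℝ) (mq : Fin Nf → ℝ) (μp : ℝ) (n K : ℕ) (x : Fin K → TorusSite 4 N) (p₀ : ℝ),
      0 ≤ p₀ → p₀ ≤ 1 / 2 →
      qcdPhaseQuenchedExpect β N mq (fun U => |1 - 2 * flipProp β mq μp (unionLinks n K x) U|) ≤
        (1 - 2 * p₀) ^ K +
          qcdPhaseQuenchedExpect β N mq
            (fun U => |(1 - 2 * locFlipProp β mq μp n K x U) - ∏ i, (1 - 2 * margFlipProp β mq μp n K x i U)|) +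
          2 * qcdPhaseQuenchedExpect β N mq
            (fun U => |flipProp β mq μp (unionLinks n K x) U - locFlipProp β mq μp n K x U|) +
          2 * qcdPhaseQuenchedExpect β N mq
            (fun U => if (∃ i, margFlipProp β mq μp n K x i U < p₀ ∨ 1 - p₀ < margFlipProp β mq μp n K x i U)
              then (1 : ℝ) else 0) := by
  sorry

/-- **Stub 3 — `signLocality` (OPEN; UV-regime; size L).** Along the line's regularisation `lineReg N_f T` (every depth
`T ≥ T₀`, threshold `M₀ ≥ 2T`, tuple `m > M₀`), for blocks of physical side `L_b ≤ L₀(m)`, any separation `d₀ ≥ L_b` and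
any number `K` of blocks, from some physical size `R` on: for every depth `M > M₀`, eventually in `k`, on every odd torus of
side `≥ R` and every separated family, `⟨|m_B − m_B^{loc}|⟩₊ ≤ 1/32` — resampling the union flips the GLOBAL determinant
sign iff it flips an odd number of LOCAL parities (signs of the enlarged Dirichlet boxes, collar `n` around each block), up
to conditional probability 1/32 on average. Why plausibly true: a discrepancy needs a real-eigenvalue crossing whose mass
lies within the resampling sensitivity of the probe — a carrier at the size threshold `ρ_* = (c_I Z_m/(a_k M))^{1/2}`
(physical `∝ a_k^{1/2} → 0`, density `(ρ_* Λ)^{b} ρ_*^{−4} → 0`, `b > 4`) or a carrier straddling a box wall at distance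
`≥ n` from the resampled links (wall shift `≲ 1/n² = a_k²/L_b² ≪ a_k M/Z_m`); instantons of size `< n` created inside a
block are crossed at the probe for BOTH operators (`c_I/ρ² ≪ a_kM/Z_m` eventually); far carriers are untouched by the
resampling. Everything happens at scales `≤ 3L_b ≪ 1/Λ`. Why open: an upper bound on the phase-quenched probability of a
near-threshold spectral event, uniform over arbitrarily large (IR-coupled) tori — no such bound is in the tree. -/
theorem stub_signLocality :
    ∀ Nf : ℕ, (Nf = 2 ∨ Nf = 3) → ∃ T₀ : ℝ, 0 < T₀ ∧ ∀ T : ℝ, T₀ ≤ T → ∀ M₀ : ℝ, 2 * T ≤ M₀ →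
      ∀ m : Fin Nf → ℝ, (∀ f, M₀ < m f) → ∃ L₀ : ℝ, 0 < L₀ ∧ ∀ Lb : ℝ, 0 < Lb → Lb ≤ L₀ →
      ∀ d₀ : ℝ, Lb ≤ d₀ → ∀ K : ℕ, ∃ R : ℝ, 0 < R ∧ ∀ M : ℝ, M₀ < M → ∀ᶠ k : ℕ in Filter.atTop, ∀ S : ℕ,
      R ≤ (lineReg Nf T).a k * (2 * S + 1) →
      ∀ x : Fin K → TorusSite 4 (2 * S + 1), Separated (sideOf (lineReg Nf T) Lb k) (sideOf (lineReg Nf T) d₀ k) x →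
        qcdPhaseQuenchedExpect ((lineReg Nf T).β k) (2 * S + 1) (mqOf (lineReg Nf T) m k)
          (fun U => |flipProp ((lineReg Nf T).β k) (mqOf (lineReg Nf T) m k) (probeOf (lineReg Nf T) M k) (unionLinks (sideOf (lineReg Nf T) Lb k) K x) U - locFlipProp ((lineReg Nf T).β k) (mqOf (lineReg Nf T) m k) (probeOf (lineReg Nf T) M k) (sideOf (lineReg Nf T) Lb k) K x U|) ≤ 1 / 32 := by
  sorry

/-- **Stub 4 — `quasiProduct` (OPEN; UV-regime; an IDENTITY at `N_f = 0`; size L).** Same prefix, with the separation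
allowed to depend on the number of blocks (`∀ K ∃ D₀ ∀ d₀ ≥ D₀`): `⟨|(1 − 2m^{loc}) − ∏_i (1 − 2r_i)|⟩₊ ≤ 1/32` — under
the exterior-conditional law of the union, the `K` local parity flips are independent up to 1/32 in the parity generating
function. The pure-gauge part is EXACT: the Wilson action is a sum over plaquettes, a separated family has no plaquette
meeting two blocks, so `S_W(r_B U V) − S_W(U) = Σ_i [S_W(r_{B_i} U V) − S_W(U)]` and the Haar product factorises — the
conditional law of `(V|_{B_1}, …, V|_{B_K})` given the exterior is a product, and each `boxParity` of block `i` reads only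
`V|_{B_i}` and the exterior (enlarged boxes are separated); hence `1 − 2m^{loc} = ∏(1 − 2r_i)` identically when the weight
has no determinant. The content is the factor `∏_f |det D_W(r_B U V, m_f(k))|`: its mixed dependence on two blocks at
physical distance `≥ d₀` is a heavy-quark loop, `≲ e^{−2 m_f d₀}` with `m_f > M₀ = 2T` heavy — quasi-locality of the
phase-quenched weight at the scale `1/M₀ ≪ L_b ≤ d₀` (decoupling), summed over `K` blocks (hence `D₀ = D₀(K)`). Why open:
locality of `log|det D_W|` at `κ → κ_c(β)⁻` is not deterministic (exceptional configurations) — it is a fractional-moment /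
Combes–Thomas statement for `γ₅D_W` in typical fields (sibling routes WilsonMobilityGap / PauliWegnerSea), needed here only
as a total-variation bound on `K` Bernoulli variables. -/
theorem stub_quasiProduct :
    ∀ Nf : ℕ, (Nf = 2 ∨ Nf = 3) → ∃ T₀ : ℝ, 0 < T₀ ∧ ∀ T : ℝ, T₀ ≤ T → ∀ M₀ : ℝ, 2 * T ≤ M₀ →
      ∀ m : Fin Nf → ℝ, (∀ f, M₀ < m f) → ∃ L₀ : ℝ, 0 < L₀ ∧ ∀ Lb : ℝ, 0 < Lb → Lb ≤ L₀ →
      ∀ K : ℕ, ∃ D₀ : ℝ, Lb ≤ D₀ ∧ ∀ d₀ : ℝ, D₀ ≤ d₀ → ∃ R : ℝ, 0 < R ∧ ∀ M : ℝ, M₀ < M →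
      ∀ᶠ k : ℕ in Filter.atTop, ∀ S : ℕ, R ≤ (lineReg Nf T).a k * (2 * S + 1) →
      ∀ x : Fin K → TorusSite 4 (2 * S + 1), Separated (sideOf (lineReg Nf T) Lb k) (sideOf (lineReg Nf T) d₀ k) x →
        qcdPhaseQuenchedExpect ((lineReg Nf T).β k) (2 * S + 1) (mqOf (lineReg Nf T) m k)
          (fun U => |(1 - 2 * locFlipProp ((lineReg Nf T).β k) (mqOf (lineReg Nf T) m k) (probeOf (lineReg Nf T) M k) (sideOf (lineReg Nf T) Lb k) K x U) -
            ∏ i, (1 - 2 * margFlipProp ((lineReg Nf T).β k) (mqOf (lineReg Nf T) m k) (probeOf (lineReg Nf T) M k) (sideOf (lineReg Nf T) Lb k) K x i U)|) ≤ 1 / 32 := by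
  sorry

/-- **Stub 5 — `blockParityFloor` (OPEN; UV-regime SEMICLASSICS; the line's HARDEST stub; size XL).** Along
`lineReg N_f T` (`T ≥ T₀`, `M₀ ≥ 2T`, `m > M₀`), for every block side `L_b ≤ L₀(m)` there is a TWO-SIDED floor
`p₀ = p₀(m, L_b) ∈ (0, 1/2]` such that for every separation `d₀ ≥ L_b` and every `K`, from some `R` on, for every depth
`M > M₀`, eventually in `k`, every odd torus of side `≥ R` carries a separated family of `K` blocks with
`P₊(∃ i, r_i ∉ [p₀, 1 − p₀]) ≤ 1/32`: conditionally on a typical exterior, resampling block `i` flips its local parity with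
probability neither `< p₀` nor `> 1 − p₀`. Why plausibly true: `r_i ≈ P(odd number of instantons of size ∈ [ρ_*, n] in
the block | boundary links)` or its complement, and in a block of physical side `L_b ≪ 1/Λ_eff(m)` (weakly coupled from
`a_k` up to `L_b`) the dilute-gas weight of ONE instanton of size `≍ L_b/4` is `≍ C_N (L_bΛ)^{b}`, `b = 11 − 2N_f/3`
(heavy flavours decoupled: effective `b = 11` with `Λ_eff(m)`), POSITIVE and `k`-UNIFORM because the one-loop determinant
converts `e^{−S_I β_k}` into `(ρΛ)^b` (dimensional transmutation at the UV-CONVERGENT end, 't Hooft 1976; lattice index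
theorem for smooth fields, Lüscher 1982) — NOT a Haar small-ball estimate (barrier `UnitaryHaarSmallBall`: the compensating
factor is the fluctuation determinant, which a proof must control: Bałaban-regime Gaussian integration around a lattice
instanton in a box whose every running coupling is small). The located line matters: the crossing mass `m_c − c_I/ρ²` of
such an instanton lies ABOVE the probe `jumpLine − a_kM/Z_m` iff `jumpLine` sits at the physical parity-jump line to
`O(a_kT/Z_m)` — which the supremum locator delivers PROVIDED parity mixes on the reference torus (`refNeg ≈ 1/2 ≥ 3/8`
below the line): that non-perturbative input is thereby localised to ONE reference statistic and to small conditioned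
blocks. `L₀`, `p₀` depend on `m` (heavier sea ⇒ larger `Λ_eff` ⇒ smaller blocks), as the crux's `∀ m ∃ R` allows. Why
open: no k-uniform lower bound on any phase-quenched probability of a spectral event of `D_W` exists (constructive QFT in
the UV-complete regime; not the mass gap). -/
theorem stub_blockParityFloor :
    ∀ Nf : ℕ, (Nf = 2 ∨ Nf = 3) → ∃ T₀ : ℝ, 0 < T₀ ∧ ∀ T : ℝ, T₀ ≤ T → ∀ M₀ : ℝ, 2 * T ≤ M₀ →
      ∀ m : Fin Nf → ℝ, (∀ f, M₀ < m f) → ∃ L₀ : ℝ, 0 < L₀ ∧ ∀ Lb : ℝ, 0 < Lb → Lb ≤ L₀ →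
      ∃ p₀ : ℝ, 0 < p₀ ∧ p₀ ≤ 1 / 2 ∧ ∀ d₀ : ℝ, Lb ≤ d₀ → ∀ K : ℕ, ∃ R : ℝ, 0 < R ∧ ∀ M : ℝ, M₀ < M →
      ∀ᶠ k : ℕ in Filter.atTop, ∀ S : ℕ, R ≤ (lineReg Nf T).a k * (2 * S + 1) →
      ∃ x : Fin K → TorusSite 4 (2 * S + 1), Separated (sideOf (lineReg Nf T) Lb k) (sideOf (lineReg Nf T) d₀ k) x ∧
        qcdPhaseQuenchedExpect ((lineReg Nf T).β k) (2 * S + 1) (mqOf (lineReg Nf T) m k)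
          (fun U => if (∃ i, margFlipProp ((lineReg Nf T).β k) (mqOf (lineReg Nf T) m k) (probeOf (lineReg Nf T) M k) (sideOf (lineReg Nf T) Lb k) K x i U < p₀ ∨
              1 - p₀ < margFlipProp ((lineReg Nf T).β k) (mqOf (lineReg Nf T) m k) (probeOf (lineReg Nf T) M k) (sideOf (lineReg Nf T) Lb k) K x i U) then (1 : ℝ) else 0) ≤ 1 / 32 := by
  sorry

/-- **Stub 6 — `uvEarlyCrossers` (OPEN; UV-regime; size L–XL).** Along `lineReg N_f T` (`T ≥ T₀`, `M₀ ≥ 2T`) there are a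
leaf size `b₀ ≥ 2` and a window `ℓ > 0` (to be taken `≪ 1/Λ_eff`: every window cell weakly coupled) such that every tuple
`m > M₀` has a size `R` from which the PARITY-FREE EARLY-CROSSER BOUND holds: for every `ε > 0`, eventually in `k`, on
every odd torus of side `≥ R`, levels `δ_j ≥ 0` with `Σ_{j<J} δ_j ≤ ε` bound the phase-quenched probability of EVERY event
contained in "the window box or one of its 16 children is singular at some bare mass `≥` a valence mass" (the (a′) clause
of the route's `EarlyCrosserLaw`, VERBATIM, instantiated at the explicit `lineReg` — a one-sided upper bound on a monotone
event family; the composition turns it into the crux's clause (a) by the LANDED `signDefectForcesCrossing_proof`).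
Content: valence masses sit `≥ a_k(m + T)/Z_m` above the located line; a crossing above them is kinematically impossible
below cell side `π(2/|m_c|)^{1/2}` (landed `KineticEdge`) and a large deviation above it whose rate grows without bound
in `k` (crossing-mass spread `O(a_k²)` of physical carriers against the offset `a_k m/Z_m`; route L4/L5), in cells of
physical size `≤ ℓ ≪ 1/Λ` (UV-convergent instanton count `(ℓΛ)^{b}`, no IR). After the proposed route split this stub is
the child `DiluteAlongLocatedLines` instantiated at `lineReg`. Why open: as `EarlyCrosserLaw` (a′) — an upper bound on a
phase-quenched probability of a spectral event of Dirichlet cells, uniform in the volume. -/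
theorem stub_uvEarlyCrossers :
    ∀ Nf : ℕ, (Nf = 2 ∨ Nf = 3) → ∃ T₀ : ℝ, 0 < T₀ ∧ ∀ T : ℝ, T₀ ≤ T → ∀ M₀ : ℝ, 2 * T ≤ M₀ →
      ∃ b₀ : ℕ, 2 ≤ b₀ ∧ ∃ ℓ : ℝ, 0 < ℓ ∧ ∀ m : Fin Nf → ℝ, (∀ f, M₀ < m f) → ∃ R : ℝ, 0 < R ∧
      let reg : QCDRegularisation Nf := lineReg Nf T; (∀ ε : ℝ, 0 < ε → ∀ᶠ k : ℕ in Filter.atTop, ∀ S : ℕ, R ≤ reg.a k * (2 * S + 1) → let N : ℕ := 2 * S + 1; let mq : Fin Nf → ℝ := fun f => reg.mcrit k + reg.a k * m f / reg.Zm k; let wt : GaugeConfig 4 N (Matrix.specialUnitaryGroup (Fin 3) ℂ) → ℝ := fun U => ∏ f, ‖fermionDet (wilsonDirac (fundamentalRep (Fin 3)) U (mq f) 1)‖; let P : (GaugeConfig 4 N (Matrix.specialUnitaryGroup (Fin 3) ℂ) → Prop) → ℝ := fun E => (∫ U, (if E U then (1 : ℝ) else 0) * wt U ∂(wilsonMeasure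 (d := 4) (L := N) (fundamentalRep (Fin 3)) (reg.β k))) / (∫ U, wt U ∂(wilsonMeasure (d := 4) (L := N) (fundamentalRep (Fin 3)) (reg.β k))); let J : ℕ := Nat.log 2 (⌊ℓ / reg.a k⌋₊ / b₀) + 1; ∃ δ : ℕ → ℝ, (∀ j, 0 ≤ δ j) ∧ ∑ j ∈ Finset.range J, δ j ≤ ε ∧ ∀ j < J, ∀ s : Fin 4 → ℕ, (∀ i, b₀ * 2 ^ j ≤ s i ∧ s i < b₀ * 2 ^ (j + 2) ∧ s i ≤ N ∧ (s i : ℝ) * reg.a k ≤ ℓ) → ∀ E : GaugeConfig 4 N (Matrix.specialUnitaryGroup (Fin 3) ℂ) → Prop, (∀ U, E U → ∃ f : Fin Nf, ∃ μ' : ℝ, mq f ≤ μ' ∧ ((wilsonCell U μ' 0 s).det = 0 ∨ ∃ c : Fin 4 → Bool, (wilsonCell U μ' (halfCorner s c) (halfSides s c)).det = 0)) → P E ≤ δ j) := by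
  sorry

/-! ## The composition (PROVED, no `sorry`): the six stubs imply the crux, by name -/

/-- A power of a number in `[0, 1)` eventually drops below `1/32`. -/
theorem exists_pow_le (q : ℝ) (_hq0 : 0 ≤ q) (hq1 : q < 1) : ∃ K : ℕ, q ^ K ≤ 1 / 32 := by
  obtain ⟨K, hK⟩ := exists_pow_lt_of_lt_one (show (0 : ℝ) < 1 / 32 by norm_num) hq1
  exact ⟨K, hK.le⟩

/-- **`NegativeCellsDilute` from exactly the six stubs, cited by name** (pure logic + `6/32 ≤ 1/2`). Witness: `lineReg N_f T` with
`T := max Tᵢ`, threshold `M₀ := 2T`, the window data of stub 6; for `m > M₀`: block side `L_b := min Lᵢ`, floor `p₀` from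
stub 5, `K` with `(1 − 2p₀)^K ≤ 1/32`, separation `d₀ := D₀(K)` from stub 4, size `R := max Rᵢ`; clause (a) is stub 6
(monotone in `R`); clause (b) is stub 1 applied to the union of stub 5's separated family, whose near-half propensity is
stub 2 fed by stubs 3–5. -/
theorem NegativeCellsDilute_of : NegativeCellsDilute := by
  have h1 := stub_pinOfNearHalfResampling
  have h2 := stub_nearHalfOfLocalParities
  have h3 := stub_signLocality
  have h4 := stub_quasiProduct
  have h5 := stub_blockParityFloor
  have h6 := stub_uvEarlyCrossers
  intro Nf hNf
  have hSDFC := Summit.QuantumFields.QCD.Theorems.signDefectForcesCrossing_proof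
  obtain ⟨T₃, hT₃, H3⟩ := h3 Nf hNf
  obtain ⟨T₄, hT₄, H4⟩ := h4 Nf hNf
  obtain ⟨T₅, hT₅, H5⟩ := h5 Nf hNf
  obtain ⟨T₆, hT₆, H6⟩ := h6 Nf hNf
  set T : ℝ := max (max T₃ T₄) (max T₅ T₆) with hTdef
  have hT3 : T₃ ≤ T := le_trans (le_max_left _ _) (le_max_left _ _)
  have hT4 : T₄ ≤ T := le_trans (le_max_right _ _) (le_max_left _ _)
  have hT5 : T₅ ≤ T := le_trans (le_max_left _ _) (le_max_right _ _)
  have hT6 : T₆ ≤ T := le_trans (le_max_right _ _) (le_max_right _ _)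
  have hTpos : 0 < T := lt_of_lt_of_le hT₃ hT3
  have hM₀ : (0 : ℝ) ≤ 2 * T := by linarith
  obtain ⟨b₀, hb₀, ℓ, hℓ, H6a⟩ := H6 T hT6 (2 * T) le_rfl
  refine ⟨lineReg Nf T, lineReg_hasMassScaling Nf T, lineReg_hasAsymptoticScaling Nf T, 2 * T, hM₀, b₀, hb₀, ℓ, hℓ,
    fun m hm => ?_⟩
  obtain ⟨R₆, hR₆, HA⟩ := H6a m hm
  obtain ⟨L₃, hL₃, H3a⟩ := H3 T hT3 (2 * T) le_rfl m hm
  obtain ⟨L₄, hL₄, H4a⟩ := H4 T hT4 (2 * T) le_rfl m hm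
  obtain ⟨L₅, hL₅, H5a⟩ := H5 T hT5 (2 * T) le_rfl m hm
  set Lb : ℝ := min L₃ (min L₄ L₅) with hLbdef
  have hLb3 : Lb ≤ L₃ := min_le_left _ _
  have hLb4 : Lb ≤ L₄ := le_trans (min_le_right _ _) (min_le_left _ _)
  have hLb5 : Lb ≤ L₅ := le_trans (min_le_right _ _) (min_le_right _ _)
  have hLb : 0 < Lb := lt_min hL₃ (lt_min hL₄ hL₅)
  obtain ⟨p₀, hp₀, hp₀h, H5b⟩ := H5a Lb hLb hLb5
  obtain ⟨K, hK⟩ := exists_pow_le (1 - 2 * p₀) (by linarith) (by linarith)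
  obtain ⟨D₄, hD₄, H4b⟩ := H4a Lb hLb hLb4 K
  obtain ⟨R₃, hR₃, H3b⟩ := H3a Lb hLb hLb3 D₄ hD₄ K
  obtain ⟨R₄, hR₄, H4c⟩ := H4b D₄ le_rfl
  obtain ⟨R₅, hR₅, H5c⟩ := H5b D₄ hD₄ K
  set R : ℝ := max (max R₃ R₄) (max R₅ R₆) with hRdef
  have hR3 : R₃ ≤ R := le_trans (le_max_left _ _) (le_max_left _ _)
  have hR4 : R₄ ≤ R := le_trans (le_max_right _ _) (le_max_left _ _)
  have hR5 : R₅ ≤ R := le_trans (le_max_left _ _) (le_max_right _ _)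
  have hR6 : R₆ ≤ R := le_trans (le_max_right _ _) (le_max_right _ _)
  refine ⟨R, lt_of_lt_of_le hR₃ hR3, ?_, ?_⟩
  · intro ε hε
    filter_upwards [HA ε hε] with k hk
    intro S hS
    obtain ⟨δ, -, hsum, hbox⟩ := hk S (le_trans hR6 hS)
    refine ⟨δ, hsum, fun j hj s hs => hbox j hj s hs _ ?_⟩
    rintro U ⟨f, hdef⟩
    obtain ⟨μ', hμ', hz⟩ := hSDFC (2 * S + 1) U _ j s hdef
    exact ⟨f, μ', hμ', hz⟩
  · apply h1 Nf (lineReg Nf T) (2 * T) m R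
    intro M hM
    filter_upwards [H3b M hM, H4c M hM, H5c M hM] with k hk3 hk4 hk5
    intro S hS
    obtain ⟨x, hsep, hbad⟩ := hk5 S (le_trans hR5 hS)
    refine ⟨unionLinks (sideOf (lineReg Nf T) Lb k) K x, ?_⟩
    have h3x := hk3 S (le_trans hR3 hS) x hsep
    have h4x := hk4 S (le_trans hR4 hS) x hsep
    have h2x := h2 (2 * S + 1) Nf ((lineReg Nf T).β k) (mqOf (lineReg Nf T) m k) (probeOf (lineReg Nf T) M k)
      (sideOf (lineReg Nf T) Lb k) K x p₀ hp₀.le hp₀h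
    have hpow : (0 : ℝ) ≤ (1 - 2 * p₀) ^ K := pow_nonneg (by linarith) K
    linarith

end Summit.QuantumFields.QCD.Cruxes.NegativeCellsDilute.ExteriorConditionedParity

end
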